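import Literature.Analysis.FunctionSpaces.UniformRandomWalkDensity
import Literature.Analysis.SpecialFunctions.JacobiThetaAGM
import HarnessLib

/-!
# Borwein–Straub–Wan–Zudilin `p₄(1)`: the singular value `K₁₅` and eq. (5.3) as a thetanull

Fourth sibling file of `Literature/Analysis/FunctionSpaces/UniformRandomWalkDensity.lean`
(named facts `BorweinStraubWanZudilin2012_thm9` — Theorem 9 of [BorweinEtAl2012],
`p₄(1) = ∫₀^∞ tJ₀(t)⁵dt` in `Γ(k/15)`-terms — and `…_eq_5_3`, the Borwein–Zucker / Chowla–Selberg
value `K₁₅² = (1+√5)Γ(1/15)Γ(2/15)Γ(4/15)Γ(8/15)/(240π)` of the complete elliptic integral at the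
15th singular modulus, typed there by `0 < k < 1`, `K′(k) = √15 K(k)` with the tree's `ellipticK`).
The source proves Theorem 9 by a modular parametrisation of `p₄` evaluated at the CM point
`τ₀ = (√(−5/3) − 1)/2` of discriminant `−15` followed by "the Chowla–Selberg formula to evaluate
the eta functions" (§5, proof of Thm 9); every known proof ends in such a CM evaluation of
thetanulls / eta values. This file supplies the junction between that modular world and the
`ellipticK`-typing of the statement file, using Jacobi's inversion theorem of
`Literature/Analysis/SpecialFunctions/JacobiThetaAGM.lean` (`K(k_N) = (π/2)ϑ₃(i√N)²`,
`k_N² = λ(i√N)`), all PROVED: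

* `ellipticK_sq_singularModulus_fifteen` — for THE 15th singular modulus `k₁₅`
  (`0 < k < 1`, `K′ = √15 K`): `K(k₁₅) = K₁₅ = (π/2) ϑ₃(i√15)²`, and `k₁₅² = λ(i√15)`;
* `BorweinStraubWanZudilin2012_eq_5_3_iff_theta3_pow_four` — **eq. (5.3) is a thetanull value**:
  the named fact holds iff `ϑ₃(i√15)⁴ = (1 + √5)·Γ(1/15)Γ(2/15)Γ(4/15)Γ(8/15)/(60π³)` — the
  Chowla–Selberg evaluation at discriminant `−15` in its theta form (numerically both sides are
  `1.0000416…`; `ϑ₃(i√15) = 1 + 2e^{−π√15} + … = 1.0000104…`);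
* `BorweinStraubWanZudilin2012_thm9_iff_of_eq_5_3` — given (5.3), **Theorem 9 is the statement
  `p₄(1) = (3√5(√5−1)/(8π)) ϑ₃(i√15)⁴`**, i.e. the thetanull form which a modular proof of
  Theorem 9 (line (4.15) of the source at `τ₀`, or any other) has to reach; and
  `BorweinStraubWanZudilin2012_thm9_of_theta3` packages the two displayed inputs
  (the Chowla–Selberg theta value and the thetanull form of `p₄(1)`) into Theorem 9.

Nothing is assumed beyond displayed hypotheses; no named fact is introduced.

What remains for the two inputs (pointers for the next prover, all to tree theorems): the theta
value `ϑ₃(i√15)⁴ = (1+√5)G/(60π³)` is Chowla–Selberg for `ℚ(√−15)` (`h = 2`, reduced forms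
`x²+xy+4y²`, `2x²+xy+2y²`, CM points `τ₁ = (−1+i√15)/2`, `τ₂ = τ₁/2`), for which the tree already
proves Kronecker's first limit formula in exact form
(`Literature.NumberTheory.QuadraticFields.KroneckerLimit.tendsto_epsteinZeta_sub_pole_eta`,
`Z_f(s) − (2π/√D)/(s−1) → (2π/√D)(2γ − log(D/a) − 4 log|η(τ_f)|)`), the Chowla–Selberg /
Bateman–Grosswald expansion (`Literature.Barriers.RiemannHypothesis.BatemanGrosswald1964_thm1_holds`),
the class-character decomposition of `Z_Q` (`EpsteinZetaRealZerosDHClassSum.lean`), `ζ_K = ζ·L`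
and Dirichlet's class number formula for quadratic fields
(`Literature.NumberTheory.QuadraticFields.Quadratic.dedekindZeta_eq_riemannZeta_mul_LSeries`,
`LFunction_jacobiChar_one_eq_of_discr_neg/pos`), and `GH = 16π⁴` (`prod_Gamma_fifteenths`); missing
are Lerch's formula `ζ′(0,x) = log Γ(x) − ½log 2π` (for `L′(1,χ₋₁₅)`), the genus character of
`ℚ(√−15)` (`L(s,χ_genus) = L(s,χ₋₃)L(s,χ₅)`, giving `|η(τ₁)/η(τ₂)|` from `L(1,χ₋₃)L(1,χ₅)`), and the
eta–theta identity `ϑ₄(τ) = η(τ/2)²/η(τ)` (with `|ϑ₄(τ₁)| = ϑ₃(i√15)` by `theta3_sq_eq` of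
`JacobiThetaAGM.lean`). The thetanull form of `p₄(1)` is the modular identification (4.15) of the
source at `τ₀` (Chan–Zudilin's level-6 parametrisation of the Domb series plus the `A₄` equation).

## References

* [BorweinEtAl2012] J. M. Borwein, A. Straub, J. Wan, W. Zudilin, Densities of short uniform random
  walks, Canad. J. Math. 64 (2012) 961–990 = arXiv:1103.2995, §5 Thm 9 and its proof
  ("Applying the Chowla–Selberg formula … to evaluate the eta functions"), eqs. (5.2)–(5.3).
* D. F. Lawden, *Elliptic Functions and Applications* (1989), (2.2.3) `K = ½πϑ₃²`. [Lawden1989]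
* J. M. Borwein, P. B. Borwein, *Pi and the AGM* (1987), Thm 2.3 (singular moduli),
  Ch. 9 (Chowla–Selberg). [BorweinBorwein1987]
-/

noncomputable section

open _root_.Real _root_.Complex

namespace Literature.Analysis.FunctionSpaces

open Literature.Analysis.SpecialFunctions
open Literature.Probability.RandomPlanarGeometry
open Literature.Probability.RandomPlanarGeometry.KlebanZagier
open Literature.NumberTheory.EllipticCurves.JacobiThetaNull

/-- **`K₁₅ = (π/2)ϑ₃(i√15)²`**: at the 15th singular modulus (`0 < k < 1`, `K′(k) = √15 K(k)`,
the typing of `K₁₅` in `BorweinStraubWanZudilin2012_eq_5_3`) the complete elliptic integral is the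
thetanull square at `τ = i√15`. [cite: Lawden1989, §2.2 eq. (2.2.3)] -/
theorem ellipticK_sq_singularModulus_fifteen {k : ℝ} (hk0 : 0 < k) (hk1 : k < 1)
    (hk : ellipticK (1 - k ^ 2) = Real.sqrt 15 * ellipticK (k ^ 2)) :
    ellipticK (k ^ 2) = π / 2 * (theta3 (I * ↑(Real.sqrt 15))).re ^ 2 :=
  ellipticK_singularModulus_eq (by norm_num) hk0 hk1 hk

/-- **`k₁₅² = λ(i√15) = ϑ₂(i√15)⁴/ϑ₃(i√15)⁴`** for the 15th singular modulus.
[cite: BorweinBorwein1987, Thm 2.3] -/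
theorem singularModulus_fifteen_sq_eq_lamR {k : ℝ} (hk0 : 0 < k) (hk1 : k < 1)
    (hk : ellipticK (1 - k ^ 2) = Real.sqrt 15 * ellipticK (k ^ 2)) :
    k ^ 2 = lamR (Real.sqrt 15) :=
  singularModulus_sq_eq_lamR (by norm_num) hk0 hk1 hk

/-- The algebra between the two forms of the Chowla–Selberg value at `−15`:
`((π/2)T²)² = (1+√5)G/(240π) ⟺ T⁴ = (1+√5)G/(60π³)`. [folklore] -/
theorem pi_div_two_mul_sq_sq_eq_iff (T G : ℝ) :
    (π / 2 * T ^ 2) ^ 2 = (1 + Real.sqrt 5) * G / (240 * π) ↔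
      T ^ 4 = (1 + Real.sqrt 5) * G / (60 * π ^ 3) := by
  have hπ := Real.pi_pos
  constructor
  · intro h
    field_simp at h
    field_simp
    nlinarith [h]
  · intro h
    field_simp at h
    field_simp
    nlinarith [h]

/-- **Eq. (5.3) of Borwein–Straub–Wan–Zudilin is a thetanull value**: the named fact
`BorweinStraubWanZudilin2012_eq_5_3` (`(√5/40)G/π⁴ = (3√5/π³)((√5−1)/2)K₁₅²`, equivalently the
Borwein–Zucker value `K₁₅² = (1+√5)G/(240π)`, `G = Γ(1/15)Γ(2/15)Γ(4/15)Γ(8/15)`) holds iff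
`ϑ₃(i√15)⁴ = (1 + √5)·G/(60π³)` — Chowla–Selberg at discriminant `−15` in theta form
(`K₁₅ = (π/2)ϑ₃(i√15)²`). [cite: BorweinEtAl2012, §5 eq. (5.3)] -/
theorem BorweinStraubWanZudilin2012_eq_5_3_iff_theta3_pow_four :
    BorweinStraubWanZudilin2012_eq_5_3 ↔
      (theta3 (I * ↑(Real.sqrt 15))).re ^ 4 =
        (1 + Real.sqrt 5) *
            (Real.Gamma (1 / 15) * Real.Gamma (2 / 15) * Real.Gamma (4 / 15) *
              Real.Gamma (8 / 15)) / (60 * π ^ 3) := by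
  rw [BorweinStraubWanZudilin2012_eq_5_3_iff_ellipticK_sq]
  constructor
  · rintro ⟨k, hk0, hk1, hk, hK⟩
    rw [ellipticK_sq_singularModulus_fifteen hk0 hk1 hk] at hK
    exact (pi_div_two_mul_sq_sq_eq_iff _ _).1 hK
  · intro hT
    obtain ⟨h0, h1, h⟩ := sqrt_lamR_isSingularModulus (N := 15) (by norm_num)
    refine ⟨Real.sqrt (lamR (Real.sqrt 15)), h0, h1, h, ?_⟩
    rw [ellipticK_sq_singularModulus_fifteen h0 h1 h]
    exact (pi_div_two_mul_sq_sq_eq_iff _ _).2 hT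

/-- **Theorem 9 in thetanull form, given (5.3)**: assuming the Chowla–Selberg input
`BorweinStraubWanZudilin2012_eq_5_3`, Theorem 9 of the source (`p₄(1)` in `Γ(k/15)` terms) is
equivalent to `p₄(1) = (3√5(√5 − 1)/(8π)) · ϑ₃(i√15)⁴` — the value a modular proof of Theorem 9
(e.g. (4.15) of the source at `τ₀ = (√(−5/3)−1)/2`) has to produce before Chowla–Selberg is
applied. [cite: BorweinEtAl2012, §5 Thm 9, eqs. (5.2)–(5.3)] -/
theorem BorweinStraubWanZudilin2012_thm9_iff_of_eq_5_3 (h3 : BorweinStraubWanZudilin2012_eq_5_3) :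
    BorweinStraubWanZudilin2012_thm9 ↔
      pearsonDensityFourAtOne =
        3 * Real.sqrt 5 * (Real.sqrt 5 - 1) / (8 * π) * (theta3 (I * ↑(Real.sqrt 15))).re ^ 4 := by
  have hT := BorweinStraubWanZudilin2012_eq_5_3_iff_theta3_pow_four.1 h3
  rw [BorweinStraubWanZudilin2012_thm9_iff_eq_5_2]
  -- (5.2) written out (robust to whether the tree carries it as a `def` or explicitly)
  show pearsonDensityFourAtOne =
      Real.sqrt 5 / 40 *
        (Real.Gamma (1 / 15) * Real.Gamma (2 / 15) * Real.Gamma (4 / 15) * Real.Gamma (8 / 15)) /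
          π ^ 4 ↔ _
  set G := Real.Gamma (1 / 15) * Real.Gamma (2 / 15) * Real.Gamma (4 / 15) * Real.Gamma (8 / 15)
  have h5 : Real.sqrt 5 ^ 2 = 5 := Real.sq_sqrt (by norm_num)
  have hπ := Real.pi_pos
  have h15 : 0 < 1 + Real.sqrt 5 := by positivity
  -- `G = 60π³T⁴/(1+√5)`, so the two right-hand sides agree
  have hG : G = 60 * π ^ 3 * (theta3 (I * ↑(Real.sqrt 15))).re ^ 4 / (1 + Real.sqrt 5) := by
    rw [hT]
    field_simp
  have e : Real.sqrt 5 / 40 * G / π ^ 4 =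
      3 * Real.sqrt 5 * (Real.sqrt 5 - 1) / (8 * π) * (theta3 (I * ↑(Real.sqrt 15))).re ^ 4 := by
    rw [hG]
    field_simp
    linear_combination (-(120 * (theta3 (I * ↑(Real.sqrt 15))).re ^ 4)) * h5
  rw [e]

/-- **Theorem 9 from its two displayed inputs**: the Chowla–Selberg thetanull value at `−15`
(`ϑ₃(i√15)⁴ = (1+√5)G/(60π³)`) and the thetanull form of `p₄(1)`
(`p₄(1) = (3√5(√5−1)/(8π))ϑ₃(i√15)⁴`) together give Theorem 9 of the source.
[cite: BorweinEtAl2012, §5 Thm 9] -/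
theorem BorweinStraubWanZudilin2012_thm9_of_theta3
    (hCS : (theta3 (I * ↑(Real.sqrt 15))).re ^ 4 =
      (1 + Real.sqrt 5) *
          (Real.Gamma (1 / 15) * Real.Gamma (2 / 15) * Real.Gamma (4 / 15) *
            Real.Gamma (8 / 15)) / (60 * π ^ 3))
    (hP : pearsonDensityFourAtOne =
      3 * Real.sqrt 5 * (Real.sqrt 5 - 1) / (8 * π) * (theta3 (I * ↑(Real.sqrt 15))).re ^ 4) :
    BorweinStraubWanZudilin2012_thm9 :=
  (BorweinStraubWanZudilin2012_thm9_iff_of_eq_5_3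
    (BorweinStraubWanZudilin2012_eq_5_3_iff_theta3_pow_four.2 hCS)).2 hP

/-- Conversely Theorem 9 and (5.3) pin the thetanull form of `p₄(1)`.
[cite: BorweinEtAl2012, §5 Thm 9, eq. (5.3)] -/
theorem pearsonDensityFourAtOne_eq_theta3_of_thm9 (h9 : BorweinStraubWanZudilin2012_thm9)
    (h3 : BorweinStraubWanZudilin2012_eq_5_3) :
    pearsonDensityFourAtOne =
      3 * Real.sqrt 5 * (Real.sqrt 5 - 1) / (8 * π) * (theta3 (I * ↑(Real.sqrt 15))).re ^ 4 :=
  (BorweinStraubWanZudilin2012_thm9_iff_of_eq_5_3 h3).1 h9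

end Literature.Analysis.FunctionSpaces
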